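import Mathlib.GroupTheory.FiniteAbelian.Basic
import Mathlib.Algebra.DirectSum.Basic
import Mathlib.Data.Fintype.Option
import HarnessLib

/-!
# Induction over finitely generated abelian groups by binary products

Topic `GroupTheory/FiniteAbelian`; namespace `Literature.GroupTheory.FiniteAbelian`.  Theorems only;
no definition, no named fact, no instance, no `sorry`.

A consequence of the structure theorem (Hungerford, *Algebra*, Thm. II.2.1: a finitely generated
abelian group is a finite direct sum of cyclic groups `ℤ` and `ℤ/m`; Mathlib
`AddCommGroup.equiv_free_prod_directSum_zmod`): a property of abelian groups which is invariant
under isomorphism, holds for the trivial group, for `ℤ` and for every `ℤ/m` (`m ≥ 1`), and is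
stable under binary products, holds for every finitely generated abelian group
(`AddCommGroup.fg_induction_prod`); the finite version `AddCommGroup.finite_induction_prod` needs
only `ℤ/m`.  Auxiliary: `directSum_induction_prod` (finite direct sums from binary products, via
`Fintype.induction_empty_option`).

Written for Route A of crux `stmt-BirchSwinnertonDyer-19295` (cell `bsd-schneider-ideate`, seat
door-c4 gen 15): the dévissage of Tate's duality maps `α^r(G, M)` for trivial `M` to `M = ℤ`,
`M = ℤ/m` (Milne ADT I Thm. 1.8, proof).  HONEST FRAMING: group theory only.

## References
* T. W. Hungerford, *Algebra*, GTM 73 (1974), Theorem II.2.1 (structure of finitely generated abelian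
  groups). [Hungerford1974]
* J. S. Milne, *Arithmetic Duality Theorems* (2nd ed. 2006), I §1, proof of Theorem 1.8. [MilneADT2006]
-/

universe u

namespace Literature.GroupTheory.FiniteAbelian

open DirectSum

/-- **Finite direct sums from binary products**: a property of abelian groups invariant under
isomorphism, true for subsingleton groups and stable under binary products holds for every finite
direct sum of groups having it. [cite: Hungerford1974, Theorem II.2.1] -/
theorem directSum_induction_prod (P : ∀ (A : Type u) [AddCommGroup A], Prop)
    (h_equiv : ∀ (A B : Type u) [AddCommGroup A] [AddCommGroup B], A ≃+ B → P A → P B)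
    (h_zero : ∀ (A : Type u) [AddCommGroup A] [Subsingleton A], P A)
    (h_prod : ∀ (A B : Type u) [AddCommGroup A] [AddCommGroup B], P A → P B → P (A × B))
    (ι : Type u) [Fintype ι] (M : ι → Type u) [∀ i, AddCommGroup (M i)] (hM : ∀ i, P (M i)) :
    P (⨁ i, M i) := by
  classical
  revert M
  refine Fintype.induction_empty_option
    (P := fun (ι : Type u) _ => ∀ (M : ι → Type u) [∀ i, AddCommGroup (M i)], (∀ i, P (M i)) → P (⨁ i, M i))
    ?_ ?_ ?_ ι
  · intro α β _ e hα M _ hM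
    exact h_equiv _ _ (DirectSum.equivCongrLeft (β := M) e.symm).symm
      (hα (fun a => M (e.symm.symm a)) fun a => hM _)
  · intro M _ _
    exact h_zero _
  · intro α _ hα M _ hM
    exact h_equiv _ _ (DirectSum.addEquivProdDirectSum (α := M)).symm
      (h_prod _ _ (hM none) (hα (fun a => M (some a)) fun a => hM (some a)))

/-- **Induction over finitely generated abelian groups by binary products** (structure theorem):
`P` invariant under `≃+`, true for subsingleton groups, for `ℤ` and for all `ZMod m` (`m ≥ 1`), and
stable under binary products, holds for every finitely generated abelian group.
[cite: Hungerford1974, Theorem II.2.1] -/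
theorem AddCommGroup.fg_induction_prod (P : ∀ (A : Type) [AddCommGroup A], Prop)
    (h_equiv : ∀ (A B : Type) [AddCommGroup A] [AddCommGroup B], A ≃+ B → P A → P B)
    (h_zero : ∀ (A : Type) [AddCommGroup A] [Subsingleton A], P A)
    (h_int : P ℤ) (h_zmod : ∀ m : ℕ, 0 < m → P (ZMod m))
    (h_prod : ∀ (A B : Type) [AddCommGroup A] [AddCommGroup B], P A → P B → P (A × B))
    (A : Type) [AddCommGroup A] [AddGroup.FG A] : P A := by
  obtain ⟨n, ι, _, p, hp, e, ⟨f⟩⟩ := AddCommGroup.equiv_free_prod_directSum_zmod A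
  refine h_equiv _ _ f.symm (h_prod _ _ ?_ ?_)
  · refine h_equiv _ _ (finsuppLequivDFinsupp (M := ℤ) (ι := Fin n) ℤ).toAddEquiv.symm ?_
    exact directSum_induction_prod P h_equiv h_zero h_prod (Fin n) (fun _ => ℤ) fun _ => h_int
  · exact directSum_induction_prod P h_equiv h_zero h_prod ι (fun i => ZMod (p i ^ e i))
      fun i => h_zmod _ (pow_pos (hp i).pos _)

/-- **Induction over finite abelian groups by binary products**: `P` invariant under `≃+`, true for
subsingleton groups and all `ZMod m` (`m ≥ 1`), stable under binary products, holds for every finite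
abelian group. [cite: Hungerford1974, Theorem II.2.1] -/
theorem AddCommGroup.finite_induction_prod (P : ∀ (A : Type) [AddCommGroup A], Prop)
    (h_equiv : ∀ (A B : Type) [AddCommGroup A] [AddCommGroup B], A ≃+ B → P A → P B)
    (h_zero : ∀ (A : Type) [AddCommGroup A] [Subsingleton A], P A)
    (h_zmod : ∀ m : ℕ, 0 < m → P (ZMod m))
    (h_prod : ∀ (A B : Type) [AddCommGroup A] [AddCommGroup B], P A → P B → P (A × B))
    (A : Type) [AddCommGroup A] [Finite A] : P A := by
  obtain ⟨ι, _, p, hp, e, ⟨f⟩⟩ := AddCommGroup.equiv_directSum_zmod_of_finite A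
  exact h_equiv _ _ f.symm (directSum_induction_prod P h_equiv h_zero h_prod ι
    (fun i => ZMod (p i ^ e i)) fun i => h_zmod _ (pow_pos (hp i).pos _))

end Literature.GroupTheory.FiniteAbelian
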